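import Literature.NumberTheory.EllipticCurves.Rank1Residual.CyclotomicWindingSpan
import Literature.NumberTheory.EllipticCurves.PeriodRelationsProofs
import HarnessLib

/-!
# Route `ByReductionTypeAtTwo` (K4), crux `OrdMissingLowerBoundAtTwo` (stmt-BirchSwinnertonDyer-19577), line
# `kato-free-lower-sandwich-two` — the torsion of `SL(2, ℤ)` and elements of `Γ₀(N)` with prescribed lower-right entry
# (`--supports`, helper; feeds `ByReductionTypeAtTwoFlatWitnessPrime`: the registered stub (W) `stub_flatWitnessAtTwo` at prime level)

Cell `bsd-2adic`, lead `cruxlead-stmt-BirchSwinnertonDyer-19577` (g2).  THEOREMS ONLY — no definition, no named fact, no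
`sorry`; closes nothing; BSD is not proved by any of this.

* §1 `pow_twelve_eq_one_of_isOfFinOrder`: an element of finite order of `SL(2, ℤ)` satisfies `γ¹² = 1` (trace `t` with
  `|t| ≥ 3` ⟹ the traces of `γⁿ` strictly increase in absolute value, so `γⁿ ≠ 1`; `t = ±2` ⟹ `γ = ±1` by nilpotency of
  `γ ∓ 1`; `t ∈ {0, ±1}` is `PeriodRelations.pow_twelve_eq_one`).  Hence `d(γ)¹² ≡ 1 (mod N)` for every finite-order
  `γ ∈ Γ₀(N)` (`gamma0Map_pow_twelve_of_isOfFinOrder`), and `d(γ) ≡ ±1 (mod p)` for `γ ∈ Γ₀(p)` of trace `±2`, `p` prime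
  (`gamma0Map_eq_of_trEntry`): the subgroup `{u : u¹² = 1} ≤ (ℤ/p)ˣ` is ADMISSIBLE for the flat witness (W).
* §2 explicit elements of `Γ₀(N)` with prescribed lower-right entry `d`: the parabolic `(2s − d, −1; (d − s)², d)`
  (`s = ±1`, `N ∣ (d − s)²`, trace `2s`) and the elliptic `(τ − d, −n; N, d)` (`d² − τd + 1 = nN`, trace `τ ∈ {0, ±1}`,
  finite order) — the single witnesses of (W).
-/

set_option linter.dupNamespace false
set_option autoImplicit false

namespace Summit.BirchSwinnertonDyer.BirchSwinnertonDyer.Theorems.FlatWitnessTwo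

open scoped MatrixGroups
open CongruenceSubgroup Literature.NumberTheory.EllipticCurves.Rank1Residual
  Literature.NumberTheory.EllipticCurves.ModularForms

/-! ## §1 Torsion of `SL(2, ℤ)`: finite order ⟹ `γ¹² = 1` -/

section Torsion

/-- Cayley–Hamilton, iterated: `γⁿ⁺² = t·γⁿ⁺¹ − γⁿ` as integer matrices, `t = tr γ`. [folklore] -/
theorem coe_pow_add_two (γ : SL(2, ℤ)) (n : ℕ) :
    ((γ ^ (n + 2) : SL(2, ℤ)) : Matrix (Fin 2) (Fin 2) ℤ) =
      (γ 0 0 + γ 1 1) • ((γ ^ (n + 1) : SL(2, ℤ)) : Matrix (Fin 2) (Fin 2) ℤ) -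
        ((γ ^ n : SL(2, ℤ)) : Matrix (Fin 2) (Fin 2) ℤ) := by
  have hsq : (γ : Matrix (Fin 2) (Fin 2) ℤ) * (γ : Matrix (Fin 2) (Fin 2) ℤ) =
      (γ 0 0 + γ 1 1) • (γ : Matrix (Fin 2) (Fin 2) ℤ) - 1 := by
    ext i j
    rw [PeriodRelations.mul_self_apply γ i j, Matrix.sub_apply, Matrix.smul_apply, smul_eq_mul]
  rw [Matrix.SpecialLinearGroup.coe_pow, Matrix.SpecialLinearGroup.coe_pow, Matrix.SpecialLinearGroup.coe_pow,
    pow_add, pow_two, hsq, mul_sub, mul_one, Matrix.mul_smul, ← pow_succ]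

/-- Entrywise form of `γⁿ⁺² = t·γⁿ⁺¹ − γⁿ`. [folklore] -/
theorem pow_add_two_apply (γ : SL(2, ℤ)) (n : ℕ) (i j : Fin 2) :
    (γ ^ (n + 2) : SL(2, ℤ)) i j = (γ 0 0 + γ 1 1) * (γ ^ (n + 1) : SL(2, ℤ)) i j - (γ ^ n : SL(2, ℤ)) i j := by
  have h := congrFun (congrFun (coe_pow_add_two γ n) i) j
  simpa only [Matrix.sub_apply, Matrix.smul_apply, smul_eq_mul] using h

/-- **Hyperbolic elements have infinite order, quantitatively**: if `|tr γ| ≥ 3` then the traces of the powers of `γ`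
strictly increase in absolute value (`|t·a − b| ≥ 3|a| − |b| > |a|` when `|a| > |b|`). [folklore] -/
theorem abs_trace_pow_lt_succ (γ : SL(2, ℤ)) (ht : 3 ≤ |γ 0 0 + γ 1 1|) (n : ℕ) :
    |(γ ^ n : SL(2, ℤ)) 0 0 + (γ ^ n : SL(2, ℤ)) 1 1| <
      |(γ ^ (n + 1) : SL(2, ℤ)) 0 0 + (γ ^ (n + 1) : SL(2, ℤ)) 1 1| := by
  induction n with
  | zero =>
    have h2 : |((1 : SL(2, ℤ)) 0 0 : ℤ) + (1 : SL(2, ℤ)) 1 1| = 2 := by simp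
    rw [pow_zero, pow_one, h2]
    linarith
  | succ n ih =>
    set t : ℤ := γ 0 0 + γ 1 1 with ht_def
    set a : ℤ := (γ ^ (n + 1) : SL(2, ℤ)) 0 0 + (γ ^ (n + 1) : SL(2, ℤ)) 1 1 with ha_def
    set b : ℤ := (γ ^ n : SL(2, ℤ)) 0 0 + (γ ^ n : SL(2, ℤ)) 1 1 with hb_def
    have hrec : (γ ^ (n + 2) : SL(2, ℤ)) 0 0 + (γ ^ (n + 2) : SL(2, ℤ)) 1 1 = t * a - b := by
      rw [pow_add_two_apply γ n 0 0, pow_add_two_apply γ n 1 1, ha_def, hb_def]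
      ring
    rw [show n + 1 + 1 = n + 2 from rfl, hrec]
    have h1 : |t| * |a| - |b| ≤ |t * a - b| := by
      have := abs_sub_abs_le_abs_sub (t * a) b
      rw [abs_mul] at this
      exact this
    have ha0 : 0 ≤ |a| := abs_nonneg a
    have h3 : 3 * |a| ≤ |t| * |a| := mul_le_mul_of_nonneg_right ht ha0
    linarith

/-- A unipotent element of `SL(2, ℤ)` (trace `2`) of finite order is the identity: `(γ − 1)² = 0` and
`γⁿ = 1 + n·(γ − 1)`. [folklore] -/
theorem eq_one_of_trace_eq_two_of_pow_eq_one (γ : SL(2, ℤ)) (ht : γ 0 0 + γ 1 1 = 2) {n : ℕ} (hn : 0 < n)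
    (hγn : γ ^ n = 1) : γ = 1 := by
  set M : Matrix (Fin 2) (Fin 2) ℤ := (γ : Matrix (Fin 2) (Fin 2) ℤ) with hM
  have hsq : M * M = (2 : ℤ) • M - 1 := by
    ext i j
    rw [hM, PeriodRelations.mul_self_apply γ i j, ht, Matrix.sub_apply, Matrix.smul_apply, smul_eq_mul]
  have hnil : (M - 1) * (M - 1) = 0 := by
    rw [sub_mul, mul_sub, mul_sub, hsq, mul_one, one_mul, one_mul, two_smul]
    abel
  -- `M^k = 1 + k • (M - 1)`
  have hpow : ∀ k : ℕ, M ^ k = 1 + (k : ℤ) • (M - 1) := by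
    intro k
    induction k with
    | zero => simp
    | succ k ih =>
      have hstep : (M - 1) * M = M - 1 := by
        have : (M - 1) * M = (M - 1) * (M - 1) + (M - 1) := by rw [mul_sub, mul_one, sub_add_cancel]
        rw [this, hnil, zero_add]
      rw [pow_succ, ih, add_mul, one_mul, Matrix.smul_mul, hstep, Nat.cast_succ, add_smul, one_smul]
      abel
  have hMn : M ^ n = 1 := by rw [hM, ← Matrix.SpecialLinearGroup.coe_pow, hγn]; rfl
  rw [hpow n] at hMn
  have hzero : (n : ℤ) • (M - 1) = 0 := by
    have := congrArg (fun X => X - (1 : Matrix (Fin 2) (Fin 2) ℤ)) hMn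
    simpa using this
  have hM1 : M = 1 := by
    ext i j
    have h := congrFun (congrFun hzero i) j
    rw [Matrix.smul_apply, smul_eq_mul, Matrix.zero_apply] at h
    have hn' : (n : ℤ) ≠ 0 := by exact_mod_cast hn.ne'
    have := (mul_eq_zero.mp h).resolve_left hn'
    rw [Matrix.sub_apply] at this
    linarith
  ext i j
  have := congrFun (congrFun hM1 i) j
  rw [hM] at this
  rw [this, Matrix.SpecialLinearGroup.coe_one]

/-- **The torsion of `SL(2, ℤ)` has exponent `12`**: an element of finite order satisfies `γ¹² = 1` (its trace `t`
has `|t| ≤ 2`: for `|t| ≥ 3` the traces of `γⁿ` grow, `abs_trace_pow_lt_succ`; `t = ±2` forces `γ = ±1`,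
`eq_one_of_trace_eq_two_of_pow_eq_one`; `t ∈ {0, ±1}` is `PeriodRelations.pow_twelve_eq_one`).
[cite: DiamondShurman2005, Exercise 2.3.7 (a)] -/
theorem pow_twelve_eq_one_of_isOfFinOrder (γ : SL(2, ℤ)) (hγ : IsOfFinOrder γ) : γ ^ 12 = 1 := by
  obtain ⟨n, hn, hγn⟩ := hγ.exists_pow_eq_one
  set t : ℤ := γ 0 0 + γ 1 1 with ht_def
  by_cases hsmall : t ^ 2 ≤ 1
  · exact PeriodRelations.pow_twelve_eq_one γ hsmall
  rcases le_or_gt 3 |t| with hbig | hmid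
  · -- hyperbolic: the traces of `γ^(m+1)` have absolute value `≥ 3`, but `γ^n = 1` has trace `2`
    exfalso
    have hge : ∀ m : ℕ, 3 ≤ |(γ ^ (m + 1) : SL(2, ℤ)) 0 0 + (γ ^ (m + 1) : SL(2, ℤ)) 1 1| := by
      intro m
      induction m with
      | zero => simpa using hbig
      | succ m ih => exact le_trans ih (le_of_lt (abs_trace_pow_lt_succ γ hbig (m + 1)))
    obtain ⟨m, rfl⟩ := Nat.exists_eq_succ_of_ne_zero hn.ne'
    have h := hge m
    rw [Nat.succ_eq_add_one] at hγn
    rw [hγn] at h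
    have h2 : |((1 : SL(2, ℤ)) 0 0 : ℤ) + (1 : SL(2, ℤ)) 1 1| = 2 := by simp
    rw [h2] at h
    omega
  · -- `|t| = 2`
    have hlt : -3 < t ∧ t < 3 := abs_lt.mp hmid
    have ht2 : t = 2 ∨ t = -2 := by
      have hout : ¬ (-1 ≤ t ∧ t ≤ 1) := by
        rintro ⟨h1, h2⟩
        exact hsmall (by nlinarith)
      omega
    rcases ht2 with h | h
    · rw [eq_one_of_trace_eq_two_of_pow_eq_one γ h hn hγn, one_pow]
    · have hneg : (-γ : SL(2, ℤ)) 0 0 + (-γ : SL(2, ℤ)) 1 1 = 2 := by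
        have e0 : ((-γ : SL(2, ℤ)) 0 0 : ℤ) = -(γ 0 0) := by
          rw [Matrix.SpecialLinearGroup.coe_neg]; rfl
        have e1 : ((-γ : SL(2, ℤ)) 1 1 : ℤ) = -(γ 1 1) := by
          rw [Matrix.SpecialLinearGroup.coe_neg]; rfl
        rw [e0, e1]
        linarith
      have hpow : (-γ) ^ (2 * n) = 1 := by
        rw [pow_mul, neg_sq, ← pow_mul, mul_comm, pow_mul, hγn, one_pow]
      have h1 := eq_one_of_trace_eq_two_of_pow_eq_one (-γ) hneg (by omega) hpow
      have hγ1 : γ = -1 := by rw [← neg_neg γ, h1]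
      rw [hγ1]
      norm_num

/-- For `γ ∈ Γ₀(N)` of finite order, `γ¹² = 1` in `Γ₀(N)`. [cite: DiamondShurman2005, Exercise 2.3.7 (a)] -/
theorem gamma0_pow_twelve_eq_one_of_isOfFinOrder {N : ℕ} (γ : Gamma0 N) (hγ : IsOfFinOrder γ) :
    γ ^ 12 = 1 := by
  have h : ((γ : SL(2, ℤ))) ^ 12 = 1 :=
    pow_twelve_eq_one_of_isOfFinOrder _ ((Gamma0 N).subtype.isOfFinOrder hγ)
  exact Subtype.ext (by rw [Subgroup.coe_pow]; exact h)

/-- For `γ ∈ Γ₀(N)` of finite order, `d(γ)¹² ≡ 1 (mod N)`. [cite: DiamondShurman2005, Exercise 2.3.7 (a)] -/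
theorem gamma0Map_pow_twelve_of_isOfFinOrder {N : ℕ} (γ : Gamma0 N) (hγ : IsOfFinOrder γ) :
    Gamma0Map N γ ^ 12 = 1 := by
  rw [← map_pow, gamma0_pow_twelve_eq_one_of_isOfFinOrder γ hγ, map_one]

/-- For `γ ∈ Γ₀(p)` of trace `±2`, `p` prime, `d(γ) ≡ ±1 (mod p)`: `(d ∓ 1)² = −bc ≡ 0`. [folklore] -/
theorem gamma0Map_eq_of_trEntry {p : ℕ} [Fact p.Prime] (γ : Gamma0 p) (hγ : trEntry γ = 2 ∨ trEntry γ = -2) :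
    Gamma0Map p γ = 1 ∨ Gamma0Map p γ = -1 := by
  have hdet : ((γ : SL(2, ℤ)) 0 0 : ℤ) * (γ : SL(2, ℤ)) 1 1 - ((γ : SL(2, ℤ)) 0 1 : ℤ) * (γ : SL(2, ℤ)) 1 0 = 1 := by
    have := Matrix.SpecialLinearGroup.det_coe (γ : SL(2, ℤ))
    rw [Matrix.det_fin_two] at this
    linear_combination this
  have hc : (((γ : SL(2, ℤ)) 1 0 : ℤ) : ZMod p) = 0 := Gamma0_mem.mp γ.2
  have hd : Gamma0Map p γ = (((γ : SL(2, ℤ)) 1 1 : ℤ) : ZMod p) := rfl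
  have hdetp : (((γ : SL(2, ℤ)) 0 0 : ℤ) : ZMod p) * (((γ : SL(2, ℤ)) 1 1 : ℤ) : ZMod p) = 1 := by
    have := congrArg (fun z : ℤ => (z : ZMod p)) hdet
    simp only [Int.cast_sub, Int.cast_mul, Int.cast_one, hc, mul_zero, sub_zero] at this
    exact this
  set a : ZMod p := (((γ : SL(2, ℤ)) 0 0 : ℤ) : ZMod p) with ha
  set d : ZMod p := (((γ : SL(2, ℤ)) 1 1 : ℤ) : ZMod p) with hd'
  rw [hd]
  rcases hγ with h | h
  · have had : a + d = 2 := by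
      have := congrArg (fun z : ℤ => (z : ZMod p)) h
      simpa [trEntry, ha, hd'] using this
    have hsq : (d - 1) ^ 2 = 0 := by
      have : a = 2 - d := by linear_combination had
      rw [this] at hdetp
      linear_combination -hdetp
    left
    exact sub_eq_zero.mp (pow_eq_zero_iff two_ne_zero |>.mp hsq)
  · have had : a + d = -2 := by
      have := congrArg (fun z : ℤ => (z : ZMod p)) h
      simpa [trEntry, ha, hd'] using this
    have hsq : (d + 1) ^ 2 = 0 := by
      have : a = -2 - d := by linear_combination had
      rw [this] at hdetp
      linear_combination -hdetp
    right
    exact eq_neg_of_add_eq_zero_left (pow_eq_zero_iff two_ne_zero |>.mp hsq)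

end Torsion

/-! ## §2 Elements of `Γ₀(N)` with prescribed lower-right entry -/

section Elements

/-- The parabolic element `(2s − d, −1; (d − s)², d) ∈ Γ₀(N)` (`s = ±1`, `N ∣ (d − s)²`): trace `2s`, lower-right entry
`d`. [cite: Manin1972, Prop. 1.4] -/
theorem exists_parabolic_dEntry (N : ℕ) (d s : ℤ) (hs : s = 1 ∨ s = -1) (hN : (N : ℤ) ∣ (d - s) ^ 2) :
    ∃ γ : Gamma0 N, trEntry γ = 2 * s ∧ dEntry γ = d := by
  have hs2 : s ^ 2 = 1 := by rcases hs with rfl | rfl <;> norm_num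
  have hdet : Matrix.det !![2 * s - d, -1; (d - s) ^ 2, d] = 1 := by
    rw [Matrix.det_fin_two_of]
    linear_combination hs2
  refine ⟨⟨⟨!![2 * s - d, -1; (d - s) ^ 2, d], hdet⟩, ?_⟩, ?_, ?_⟩
  · rw [Gamma0_mem]
    simp only [Fin.isValue, Matrix.of_apply, Matrix.cons_val', Matrix.cons_val_zero, Matrix.cons_val_one]
    exact (ZMod.intCast_zmod_eq_zero_iff_dvd _ N).mpr hN
  · simp only [trEntry, Fin.isValue, Matrix.of_apply, Matrix.cons_val', Matrix.cons_val_zero, Matrix.cons_val_one,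
      Matrix.cons_val_fin_one]
    ring
  · simp [dEntry]

/-- The elliptic element `(τ − d, −n; N, d) ∈ Γ₀(N)` (`d² − τd + 1 = nN`): trace `τ`, lower-right entry `d`; for
`τ ∈ {0, 1, −1}` it has finite order (`γ¹² = 1`). [cite: Manin1972, Prop. 1.4] -/
theorem exists_elliptic_dEntry (N : ℕ) (d τ n : ℤ) (h : d ^ 2 - τ * d + 1 = n * N) (hτ : τ ^ 2 ≤ 1) :
    ∃ γ : Gamma0 N, IsOfFinOrder γ ∧ trEntry γ = τ ∧ dEntry γ = d := by
  have hdet : Matrix.det !![τ - d, -n; (N : ℤ), d] = 1 := by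
    rw [Matrix.det_fin_two_of]
    linear_combination -h
  set γ₀ : SL(2, ℤ) := ⟨!![τ - d, -n; (N : ℤ), d], hdet⟩ with hγ₀
  have hmem : γ₀ ∈ Gamma0 N := by
    rw [Gamma0_mem, hγ₀]
    simp
  have htr : (γ₀ 0 0 : ℤ) + γ₀ 1 1 = τ := by
    rw [hγ₀]; simp
  have h12 : γ₀ ^ 12 = 1 := PeriodRelations.pow_twelve_eq_one γ₀ (by rw [htr]; exact hτ)
  refine ⟨⟨γ₀, hmem⟩, ?_, ?_, ?_⟩
  · exact isOfFinOrder_iff_pow_eq_one.mpr ⟨12, by norm_num, Subtype.ext (by rw [Subgroup.coe_pow]; exact h12)⟩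
  · show (γ₀ 0 0 : ℤ) + γ₀ 1 1 = τ
    exact htr
  · show (γ₀ 1 1 : ℤ) = d
    rw [hγ₀]; simp

end Elements

end Summit.BirchSwinnertonDyer.BirchSwinnertonDyer.Theorems.FlatWitnessTwo
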